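import Mathlib
import Summits.Ventures.PercRepro2.Defs
import Summits.Ventures.PercRepro2.Graph
import Summits.Ventures.PercRepro2.OneColourSwitch
import Summits.Ventures.PercRepro2.RegionHubSign
import Summits.Ventures.PercRepro2.SideSwitch
import Summits.Ventures.PercRepro2.SideSwitchFibre
import Summits.Ventures.PercRepro2.SideSwitchClosed
import Summits.Ventures.PercRepro2.SideSwitchComps
import Summits.Ventures.PercRepro2.M9NoPocketDefs
import Summits.Ventures.PercRepro2.M9NoPocketWorld
import Summits.Ventures.PercRepro2.M9NoPocketFibre
import Summits.Ventures.PercRepro2.M9NoPocketCompl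
import Summits.Ventures.PercRepro2.M9RegionSplit
import Summits.Ventures.PercRepro2.M9PocketCubeDefs
import Summits.Ventures.PercRepro2.M9PocketCubeFibre
import Summits.Ventures.PercRepro2.M9PocketCubeCompl
import Summits.Ventures.PercRepro2.M9PocketCubeHub
import Summits.Ventures.PercRepro2.M9PocketCubeWorldMono
import Summits.Ventures.PercRepro2.M9DeadEnd
import Summits.Ventures.PercRepro2.M9DeadEndMono
import Summits.Ventures.PercRepro2.M9DeadEndHarris
import Summits.Ventures.PercRepro2.M9LinkedHubCube
import Summits.Ventures.PercRepro2.M9LinkedGroup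
import Summits.Ventures.PercRepro2.M9LinkedGroupClosed

/-!
# Every point of the group interval of a `K`-side legal point is `K`-side legal (blind cell
PercRepro2, p3 g29, 2026-08-28; step (iii) of the `Y`-pocket-group plan, part 2)

With the closure facts of `M9LinkedGroupClosed`: no `Y`-hub on the interval
(`not_hubY_of_mem_groupInterval`: a `Y`-edge at `d` leads to `r`/`s`, to an unswitched block
vertex — in the `Y`-world of `G − d` — or into the `Y`-pocket, none of which reaches `p` or `q` in
`G − d`), hence **`Sep`** by `sep2_of_not_mem_M2_of_not_hubY` (`sep2_of_mem_groupInterval`);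
**`d ∈ K₂`** persists from `x` (`mem_K2_of_mem_groupInterval`: the `Y`-source of `d` at `x` is a
`T`-edge or a same-type edge to an unswitched block, both unchanged); **`DOne`** holds
(`DOne_of_mem_groupInterval`: a doubly reached vertex would lie in a switched block and be
`Y`-joined to `d` through a `T`-edge, an unswitched block or the `Y`-pocket — impossible).
Together (`kside_of_mem_groupInterval`): the lane's «every point of a `Y`-pocket group is a legal
`A`-point», on the pocket cube.  Own work; std axioms.
-/

namespace Summit.Ventures.PercRepro2

namespace NoPocket

open Finset Classical RegionHub OneColourSwitch SideSwitch

variable {V : Type*} {E : Type*}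

section Legal

variable [Fintype V] [DecidableEq V] [Fintype E] [DecidableEq E] {ends : E → Sym2 V}
  {p q r s d : V}

/-- **No `Y`-hub on the group interval** of a `Sep`, `K`-side point. -/
theorem not_hubY_of_mem_groupInterval (hr : d ≠ r) (hs : d ≠ s) {ρ : Config E}
    (hρ : ρ ∈ RepP ends p q r s d) {x y : Finset (Finset V) × Finset E}
    (hx : x ∈ cubeP ends d r s ρ) (hsepx : sep2 ends p q r s (assignX ends x ρ))
    (hKx : d ∈ K2 ends r s (assignX ends x ρ)) (h : y ∈ groupInterval ends d r s ρ x) :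
    ¬ hubY ends d p q (assignX ends y ρ) := by
  rintro ⟨e, u, hends, he, hc⟩
  obtain ⟨hρD, _⟩ := mem_RepP.1 hρ
  have hy := mem_cubeP_of_mem_groupInterval h
  obtain ⟨hT, hF⟩ := mem_cubeP.1 hy
  have hsepD := sep2_endsD_assignX' hr hs hρD hT hF
  obtain ⟨hpK, hqK⟩ := not_mem_K2_of_sep2 hsepD
  -- the target `t ∈ {p, q}` is outside the `Y`-world of `G − d`, outside the `Y`-pocket of `x`
  obtain ⟨t, htK, htP, hct⟩ : ∃ t, t ∉ K2 (endsD ends d) r s (assignX ends y ρ) ∧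
      t ∉ pocketY ends d r s ρ x ∧ Conn (endsD ends d) (assignX ends y ρ) u t := by
    obtain ⟨hpKx, hqKx⟩ := not_mem_K2_of_sep2 hsepx
    rcases hc with hc | hc
    · refine ⟨p, hpK, fun hp => ?_, hc⟩
      apply hpKx
      rcases mem_K2_iff.1 hKx with h1 | h1
      · exact mem_K2_iff.2 (Or.inl (conn_trans h1 (conn_d_of_mem_pocketY hp)))
      · exact mem_K2_iff.2 (Or.inr (conn_trans h1 (conn_d_of_mem_pocketY hp)))
    · refine ⟨q, hqK, fun hq => ?_, hc⟩
      apply hqKx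
      rcases mem_K2_iff.1 hKx with h1 | h1
      · exact mem_K2_iff.2 (Or.inl (conn_trans h1 (conn_d_of_mem_pocketY hq)))
      · exact mem_K2_iff.2 (Or.inr (conn_trans h1 (conn_d_of_mem_pocketY hq)))
  rcases edge_trichotomy hr hs hρD e with h1 | ⟨C, hC, z, hz, w, hzw⟩ | h1
  · exact not_within_rs_of_d_edge hr hs hends h1
  · -- the far end is in an unswitched block, hence in the `Y`-world of `G − d`
    have hzne := (block_vertex_ne hρD hC hz hr hs).2.2
    have hu : u ∈ C := by
      rw [hends, Sym2.eq_iff] at hzw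
      rcases hzw with ⟨h2, _⟩ | ⟨_, h2⟩
      · exact absurd h2.symm hzne
      · rw [h2]
        exact hz
    have hCy : C ∉ y.1 := notMem_fst_of_adj_d_of_mem_groupInterval h hC hends hu
    have huK : u ∈ K2 (endsD ends d) r s (assignX ends y ρ) := by
      rw [K2_endsD_assignX' hr hs hρD hT hF]
      refine ⟨mem_K2_endsD_of_mem_block hρD hC hu, fun huT => ?_⟩
      obtain ⟨C', hC', huC'⟩ := mem_unionT.1 (Finset.mem_coe.1 huT)
      exact hCy (block_eq_of_mem hC (hT hC') hu huC' ▸ hC')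
    apply htK
    rcases mem_K2_iff.1 huK with h2 | h2
    · exact mem_K2_iff.2 (Or.inl (conn_trans h2 hct))
    · exact mem_K2_iff.2 (Or.inr (conn_trans h2 hct))
  · rcases mem_freeE.1 h1 with hTe | hPe
    · -- a `T`-edge: `u ∈ {r, s}`
      apply htK
      rcases mem_Tset.1 hTe with h2 | h2 <;> rw [hends, Sym2.eq_iff] at h2
      · rcases h2 with ⟨_, h3⟩ | ⟨h3, _⟩
        · rw [h3] at hct
          exact mem_K2_iff.2 (Or.inl hct)
        · exact absurd h3 hr
      · rcases h2 with ⟨_, h3⟩ | ⟨h3, _⟩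
        · rw [h3] at hct
          exact mem_K2_iff.2 (Or.inr hct)
        · exact absurd h3 hs
    · -- a pocket edge: `u` and then `t` lie in the `Y`-pocket of `x`
      exact htP (mem_pocketY_of_conn_endsD hr hs hρ hx h
        (mem_pocketY_of_pocket_edge_d hρD hx h hends hPe he) hct)

/-- **`d ∈ K₂` persists on the group interval.** -/
theorem mem_K2_of_mem_groupInterval (hr : d ≠ r) (hs : d ≠ s) {ρ : Config E}
    (hρ : ρ ∈ RepP ends p q r s d) {x y : Finset (Finset V) × Finset E}
    (hx : x ∈ cubeP ends d r s ρ) (hKx : d ∈ K2 ends r s (assignX ends x ρ))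
    (h : y ∈ groupInterval ends d r s ρ x) : d ∈ K2 ends r s (assignX ends y ρ) := by
  obtain ⟨hρD, _⟩ := mem_RepP.1 hρ
  obtain ⟨hTx, hFx⟩ := mem_cubeP.1 hx
  have hy := mem_cubeP_of_mem_groupInterval h
  obtain ⟨hT, hF⟩ := mem_cubeP.1 hy
  have hex : ∃ t, (t = r ∨ t = s) ∧ Conn ends (assignX ends x ρ) t d := by
    rcases mem_K2_iff.1 hKx with h1 | h1
    · exact ⟨r, Or.inl rfl, h1⟩
    · exact ⟨s, Or.inr rfl, h1⟩
  obtain ⟨t, ht, hc⟩ := hex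
  have htd : t ≠ d := by
    rcases ht with h1 | h1 <;> rw [h1]
    · exact hr.symm
    · exact hs.symm
  obtain ⟨e, u, hends, he, hc'⟩ := conn_d_decomp htd hc
  have huK : u ∈ K2 (endsD ends d) r s (assignX ends x ρ) := by
    rcases ht with h1 | h1 <;> rw [h1] at hc'
    · exact mem_K2_iff.2 (Or.inl hc')
    · exact mem_K2_iff.2 (Or.inr hc')
  rw [K2_endsD_assignX' hr hs hρD hTx hFx] at huK
  -- the edge at `y` is still `Y` and its far end still in the `Y`-world of `G − d`
  have key : assignX ends y ρ e = true ∧ u ∈ K2 (endsD ends d) r s (assignX ends y ρ) := by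
    rcases edge_trichotomy hr hs hρD e with h1 | ⟨C, hC, z, hz, w, hzw⟩ | h1
    · exact absurd h1 (not_within_rs_of_d_edge hr hs hends)
    · have hzne := (block_vertex_ne hρD hC hz hr hs).2.2
      have hu : u ∈ C := by
        rw [hends, Sym2.eq_iff] at hzw
        rcases hzw with ⟨h2, _⟩ | ⟨_, h2⟩
        · exact absurd h2.symm hzne
        · rw [h2]
          exact hz
      have hCx : C ∉ x.1 := fun hCx => huK.2 (Finset.mem_coe.2 (mem_unionT.2 ⟨C, hCx, hu⟩))
      have hρe : ρ e = true := by
        have := assignX_block_edge' hρD hTx hFx hr hs hC hu hends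
        rw [if_neg hCx] at this
        rw [← this]
        exact he
      have hCy : C ∉ y.1 := notMem_fst_of_adj_d_of_mem_groupInterval h hC hends hu
      refine ⟨?_, ?_⟩
      · rw [assignX_block_edge' hρD hT hF hr hs hC hu hends, if_neg hCy]
        exact hρe
      · rw [K2_endsD_assignX' hr hs hρD hT hF]
        refine ⟨huK.1, fun huT => ?_⟩
        obtain ⟨C', hC', huC'⟩ := mem_unionT.1 (Finset.mem_coe.1 huT)
        exact hCy (block_eq_of_mem hC (hT hC') hu huC' ▸ hC')
    · rcases mem_freeE.1 h1 with hTe | hPe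
      · refine ⟨assignX_Tset_eq_true_of_mem_groupInterval hr hs hρ h hTe, ?_⟩
        rw [K2_endsD_assignX' hr hs hρD hT hF]
        refine ⟨huK.1, fun huT => ?_⟩
        -- `u ∈ {r, s}` is not a block vertex
        obtain ⟨C', hC', huC'⟩ := mem_unionT.1 (Finset.mem_coe.1 huT)
        obtain ⟨hur, hus, _⟩ := block_vertex_ne hρD (hT hC') huC' hr hs
        rcases mem_Tset.1 hTe with h2 | h2 <;> rw [hends, Sym2.eq_iff] at h2
        · rcases h2 with ⟨_, h3⟩ | ⟨h3, _⟩
          · exact hur h3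
          · exact hr h3
        · rcases h2 with ⟨_, h3⟩ | ⟨h3, _⟩
          · exact hus h3
          · exact hs h3
      · -- a pocket edge: its far end is outside the `Y`-world of `G − d`
        exfalso
        obtain ⟨y₁, hy₁, z₁, hz₁, hyz⟩ := mem_Pk.1 hPe
        rw [hends, Sym2.eq_iff] at hyz
        rcases hyz with ⟨_, h2⟩ | ⟨_, h2⟩
        · rw [h2] at huK
          exact (mem_Oprime.1 hz₁).1 huK.1
        · rw [h2] at huK
          exact (mem_Oprime.1 hy₁).1 huK.1
  obtain ⟨he', huK'⟩ := key
  have hdu : Conn ends (assignX ends y ρ) d u := conn_of_openAdj ⟨e, he', hends⟩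
  rcases mem_K2_iff.1 huK' with h2 | h2
  · exact mem_K2_iff.2 (Or.inl (conn_trans (conn_of_conn_endsD h2) (conn_symm hdu)))
  · exact mem_K2_iff.2 (Or.inr (conn_trans (conn_of_conn_endsD h2) (conn_symm hdu)))

/-- **`DOne` holds on the group interval** of a `K`-side point. -/
theorem DOne_of_mem_groupInterval (hr : d ≠ r) (hs : d ≠ s) {ρ : Config E}
    (hρ : ρ ∈ RepP ends p q r s d) {x y : Finset (Finset V) × Finset E}
    (hx : x ∈ cubeP ends d r s ρ) (h : y ∈ groupInterval ends d r s ρ x) :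
    DOne ends r s d (assignX ends y ρ) := by
  obtain ⟨hρD, _⟩ := mem_RepP.1 hρ
  have hy := mem_cubeP_of_mem_groupInterval h
  obtain ⟨hT, hF⟩ := mem_cubeP.1 hy
  obtain ⟨_, hMρ, _⟩ := mem_RepD.1 hρD
  have hM := not_mem_M2_of_mem_groupInterval hr hs hρ h
  intro v hvr hvs hvd hvK hvM
  -- `v` lies in a switched block
  have hvM' : v ∈ M2 (endsD ends d) r s (assignX ends y ρ) := by
    rcases mem_M2_iff.1 hvM with h1 | h1
    · exact mem_M2_iff.2 (Or.inl (conn_endsD_of_not_conn h1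
        (fun hc => hM (mem_M2_iff.2 (Or.inl hc)))))
    · exact mem_M2_iff.2 (Or.inr (conn_endsD_of_not_conn h1
        (fun hc => hM (mem_M2_iff.2 (Or.inr hc)))))
  rw [M2_endsD_assignX' hr hs hρD hT hF] at hvM'
  have hvT : v ∈ (↑(unionT y.1) : Set V) := by
    rcases hvM' with h1 | h1
    · exfalso
      rcases hMρ v h1 with h2 | h2
      · exact hvr h2
      · exact hvs h2
    · exact h1
  have hvK' : v ∉ K2 (endsD ends d) r s (assignX ends y ρ) := by
    rw [K2_endsD_assignX' hr hs hρD hT hF]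
    exact fun h' => h'.2 hvT
  -- the `Y`-connection of `v` passes through `d`
  have hdv : Conn ends (assignX ends y ρ) d v := by
    rcases mem_K2_iff.1 hvK with h1 | h1
    · by_cases hrd : Conn ends (assignX ends y ρ) r d
      · exact conn_trans (conn_symm hrd) h1
      · exact absurd (mem_K2_iff.2 (Or.inl (conn_endsD_of_not_conn h1 hrd))) hvK'
    · by_cases hsd : Conn ends (assignX ends y ρ) s d
      · exact conn_trans (conn_symm hsd) h1
      · exact absurd (mem_K2_iff.2 (Or.inr (conn_endsD_of_not_conn h1 hsd))) hvK'
  obtain ⟨e, u, hends, he, hvu⟩ := conn_d_decomp hvd (conn_symm hdv)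
  rcases edge_trichotomy hr hs hρD e with h1 | ⟨C, hC, z, hz, w, hzw⟩ | h1
  · exact not_within_rs_of_d_edge hr hs hends h1
  · -- through an unswitched block adjacent to `d`: `v` would be in the `Y`-world of `G − d`
    have hzne := (block_vertex_ne hρD hC hz hr hs).2.2
    have hu : u ∈ C := by
      rw [hends, Sym2.eq_iff] at hzw
      rcases hzw with ⟨h2, _⟩ | ⟨_, h2⟩
      · exact absurd h2.symm hzne
      · rw [h2]
        exact hz
    have hCy : C ∉ y.1 := notMem_fst_of_adj_d_of_mem_groupInterval h hC hends hu
    have huK : u ∈ K2 (endsD ends d) r s (assignX ends y ρ) := by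
      rw [K2_endsD_assignX' hr hs hρD hT hF]
      refine ⟨mem_K2_endsD_of_mem_block hρD hC hu, fun huT => ?_⟩
      obtain ⟨C', hC', huC'⟩ := mem_unionT.1 (Finset.mem_coe.1 huT)
      exact hCy (block_eq_of_mem hC (hT hC') hu huC' ▸ hC')
    apply hvK'
    rcases mem_K2_iff.1 huK with h2 | h2
    · exact mem_K2_iff.2 (Or.inl (conn_trans h2 (conn_symm hvu)))
    · exact mem_K2_iff.2 (Or.inr (conn_trans h2 (conn_symm hvu)))
  · rcases mem_freeE.1 h1 with hTe | hPe
    · -- through a `T`-edge: `v` would be in the `Y`-world of `G − d`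
      apply hvK'
      rcases mem_Tset.1 hTe with h2 | h2 <;> rw [hends, Sym2.eq_iff] at h2
      · rcases h2 with ⟨_, h3⟩ | ⟨h3, _⟩
        · rw [h3] at hvu
          exact mem_K2_iff.2 (Or.inl (conn_symm hvu))
        · exact absurd h3 hr
      · rcases h2 with ⟨_, h3⟩ | ⟨h3, _⟩
        · rw [h3] at hvu
          exact mem_K2_iff.2 (Or.inr (conn_symm hvu))
        · exact absurd h3 hs
    · -- through the `Y`-pocket: `v` would be a pocket vertex, not a block vertex
      have hvP : v ∈ pocketY ends d r s ρ x :=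
        mem_pocketY_of_conn_endsD hr hs hρ hx h
          (mem_pocketY_of_pocket_edge_d hρD hx h hends hPe he) (conn_symm hvu)
      obtain ⟨C, hC, hvC⟩ := mem_unionT.1 (Finset.mem_coe.1 hvT)
      exact (mem_Oprime.1 (mem_Oprime_of_mem_pocketY hr hs hvP)).1
        (mem_K2_endsD_of_mem_block hρD (hT hC) hvC)

/-- **`Sep` holds on the group interval** of a `Sep`, `K`-side point. -/
theorem sep2_of_mem_groupInterval (hr : d ≠ r) (hs : d ≠ s) (hpd : p ≠ d) (hqd : q ≠ d)
    {ρ : Config E} (hρ : ρ ∈ RepP ends p q r s d) {x y : Finset (Finset V) × Finset E}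
    (hx : x ∈ cubeP ends d r s ρ) (hsepx : sep2 ends p q r s (assignX ends x ρ))
    (hKx : d ∈ K2 ends r s (assignX ends x ρ)) (h : y ∈ groupInterval ends d r s ρ x) :
    sep2 ends p q r s (assignX ends y ρ) := by
  obtain ⟨hρD, _⟩ := mem_RepP.1 hρ
  obtain ⟨hT, hF⟩ := mem_cubeP.1 (mem_cubeP_of_mem_groupInterval h)
  exact sep2_of_not_mem_M2_of_not_hubY hpd hqd (sep2_endsD_assignX' hr hs hρD hT hF)
    (not_mem_M2_of_mem_groupInterval hr hs hρ h)
    (not_hubY_of_mem_groupInterval hr hs hρ hx hsepx hKx h)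

/-- **Every point of the group interval of a `Sep`, `K`-side point is a `Sep`, `DOne`, `K`-side
point** (the lane's «every point of a `Y`-pocket group is a legal `A`-point»). -/
theorem kside_of_mem_groupInterval (hr : d ≠ r) (hs : d ≠ s) (hpd : p ≠ d) (hqd : q ≠ d)
    {ρ : Config E} (hρ : ρ ∈ RepP ends p q r s d) {x y : Finset (Finset V) × Finset E}
    (hx : x ∈ cubeP ends d r s ρ) (hsepx : sep2 ends p q r s (assignX ends x ρ))
    (hKx : d ∈ K2 ends r s (assignX ends x ρ)) (h : y ∈ groupInterval ends d r s ρ x) :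
    sep2 ends p q r s (assignX ends y ρ) ∧ DOne ends r s d (assignX ends y ρ) ∧
      d ∈ K2 ends r s (assignX ends y ρ) ∧ d ∉ M2 ends r s (assignX ends y ρ) :=
  ⟨sep2_of_mem_groupInterval hr hs hpd hqd hρ hx hsepx hKx h,
    DOne_of_mem_groupInterval hr hs hρ hx h, mem_K2_of_mem_groupInterval hr hs hρ hx hKx h,
    not_mem_M2_of_mem_groupInterval hr hs hρ h⟩

end Legal

end NoPocket

end Summit.Ventures.PercRepro2
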